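import Summits.ABC.IUTFork.Joshi.LogVolumesHulls
import Summits.ABC.IUTFork.Joshi.ATS3FundamentalEstimate

/-!
# [J-III] Thm. 9.11.1, proof step «the volume of this set can be bounded by Lemma 9.10.7.1» — the §9.10 objects
# projected onto E-t4's `ATS3.LocusDatum`, with `HullVolumeLowerBound` DISCHARGED

K. Joshi, *Construction of Arithmetic Teichmüller Spaces III* (arXiv:2401.13508 **v4**, unrefereed; bib `Joshi2024ATS3`;
render `HOME/lit/renders/Joshi-arxiv-2401.13508/pNNNN.txt`), proof of Thm. 9.11.1, p.127 l.41–55: «By the construction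
of these sets, Θ̃^𝓘_Mochizuki contains the classes Ξ_z … obtained using the standard point of Σ̃_{L′} and hence it
contains a subset of the type considered in Lemma 9.10.7.1, ∏_{w} (τ_1𝒪_{L′_{w,1}}) ⊗_{ℤ_p} … ⊗_{ℤ_p} (τ_{ℓ*}𝒪_{L′_{w,ℓ*}}),
with τ_j = log_BK(Ξ_{0,z_j,w}) … So the volume of this set can be bounded by Lemma 9.10.7.1.»
Cell abc-iut, block E (rung LADDER-ABC:A2.E), seat E-t23 (slot T-23), per E-plan-2 ruling R-a (06:20:25Z) and E-t4's
CARRIER PROPOSAL (06:27:08Z): the richer §9.10 carrier (`LogVol.TensorVolumeDatum`, p428811) EXPORTS a projection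
`toLocusDatum` onto E-t4's minimal real-number carrier `ATS3.LocusDatum ℓ*` (p428048), and the reading predicate
`ATS3.LocusDatum.HullVolumeLowerBound` («Lemma 9.10.7.1 applied to the exhibited element») is PROVED for the
projection from the typed Lem. 9.10.7.1 (`TensorVolumeDatum.lemma_9_10_7_1`). Consequently E-t4's proved spine gives
Thm. 9.11.1 / Cor. 9.11.1.1 at the place `w` from (9.9.4) `ValuationScaling` (+ the sign convention) ALONE — one of
the two named inputs of `fundamentalEstimateVol_of` is no longer a hypothesis but a consequence of the typed objects
plus the three printed facts recorded as FIELDS of `ExhibitedDatum` (exhibited element integral and nonzero; the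
`w`-locus contains the ball-tensor `⊗_j τ_j𝒪`; its hull has finite volume, Cor. 9.8.1.3).
FRAMING: typed ≠ proved; no side taken on [IUTchIII] Cor. 3.12 or on any author; nothing of Joshi's is asserted —
`ValuationScaling` stays a hypothesis BY NAME, and the fields of `ExhibitedDatum` are a SIGNATURE. Proof-only
companion apart from the carrier `ExhibitedDatum` and the projection `toLocusDatum` (definitions, review lane).
-/

noncomputable section

namespace Summit.ABC.IUTFork.Joshi.LogVol

open MeasureTheory

/-- **The exhibited-element datum at one place `w ∈ 𝕍^{odd,ss}_{L′}`** ([J-III] proof of Thm. 9.11.1, p.127 l.41–55):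
the §9.10 tensor-volume datum on the `ℓ*` factors `L′_{w,1}, …, L′_{w,ℓ*}` (index `i : Fin ℓ*` = label `j = i+1`),
the exhibited element `τ_j = log_BK(Ξ_{0,z_j,w})` with `0 ≠ τ_j ∈ 𝒪` (p.127 l.53; `|τ_j| = |q^{1/2ℓ}_{w;j}| < 1` by
(9.9.3)), the `w`-component locus `Θ̃^𝓘_{Mochizuki,w}` as a subset of the ambient space CONTAINING the ball-tensor
`⊗_j τ_j𝒪` (p.127 l.45–52 «contains a subset of the type considered in Lemma 9.10.7.1»), of finite hull volume (Cor.
9.8.1.3, p.116 l.63 – p.117 l.4; p.127 l.64–65 «the product is finite»), plus the two reals §9.10 does not produce: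
`|q_w^{1/2ℓ}| ∈ (0,1)` and the sup-norm (9.8.2.5). SIGNATURE (fields = printed inputs with locators; nothing
asserted). [claim: Joshi2024ATS3, status: disputed] -/
structure ExhibitedDatum (lstar : ℕ) (E : Fin lstar → Type*) [∀ i, Field (E i)] [∀ i, MeasurableSpace (E i)]
    (X : Type*) [MeasurableSpace X] extends TensorVolumeDatum (Fin lstar) E X where
  /-- `|q_w^{1/2ℓ}|_{C_{p_w}}` -/ qroot : ℝ
  /-- `0 < |q_w^{1/2ℓ}|` -/ qroot_pos : 0 < qroot
  /-- `|q_w^{1/2ℓ}| < 1` (Tate parameter) -/ qroot_lt_one : qroot < 1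
  /-- the exhibited element `τ_j = log_BK(Ξ_{0,z_j,w})` (p.127 l.53) -/ τ : ∀ i, E i
  /-- `τ_j ∈ 𝒪_{L′_{w,j}}` (Lem. 9.10.7.1 hypothesis, p.125 l.42–43) -/ τ_mem : ∀ i, τ i ∈ (D i).O
  /-- `τ_j ≠ 0` -/ τ_ne : ∀ i, τ i ≠ 0
  /-- `Θ̃^𝓘_{Mochizuki,w}` as a subset of `X` (Thm-Def 9.8.1.1; seat T-22) -/ locus : Set X
  /-- p.127 l.45–52: the locus contains the ball-tensor `(τ_1𝒪)⊗_{ℤ_p}…⊗(τ_{ℓ*}𝒪)` -/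
  tens_subset_locus : tens (fun i => (D i).ball 0 (τ i)) ⊆ locus
  /-- Cor. 9.8.1.3: the hull of the locus has finite volume -/ vol_hull_ne_top : vol (hull locus) ≠ ⊤
  /-- `|Θ̃^𝓘_{Mochizuki,w}|`, the sup-norm (9.8.2.5) (not produced by §9.10; carried for the projection) -/ supNorm : ℝ

namespace ExhibitedDatum

variable {lstar : ℕ} {E : Fin lstar → Type*} [∀ i, Field (E i)] [∀ i, MeasurableSpace (E i)] {X : Type*}
  [MeasurableSpace X] (Ξ : ExhibitedDatum lstar E X)

/-- **The projection onto E-t4's carrier** (`ATS3.LocusDatum ℓ*`, p428048): `theta j = |τ_j|_{L′_{w,j}}` (the norms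
of the exhibited element, (9.8.2.1)), `hullVol = Vol(hull Θ̃^𝓘_{Mochizuki,w})` as a real number (finite by
`vol_hull_ne_top`), `qroot`, `supNorm` carried over. [claim: Joshi2024ATS3, status: disputed] -/
def toLocusDatum : ATS3.LocusDatum lstar where
  qroot := Ξ.qroot
  qroot_pos := Ξ.qroot_pos
  qroot_lt_one := Ξ.qroot_lt_one
  theta := fun i => (Ξ.D i).abs (Ξ.τ i)
  supNorm := Ξ.supNorm
  hullVol := (Ξ.vol (Ξ.hull Ξ.locus)).toReal

/-- `theta` of the projection is the tuple of norms of the exhibited element. [folklore] -/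
theorem toLocusDatum_theta (i : Fin lstar) : Ξ.toLocusDatum.theta i = (Ξ.D i).abs (Ξ.τ i) := rfl

/-- `hullVol` of the projection is `Vol(hull locus)` read in `ℝ`. [folklore] -/
theorem toLocusDatum_hullVol : Ξ.toLocusDatum.hullVol = (Ξ.vol (Ξ.hull Ξ.locus)).toReal := rfl

/-- The exhibited element lies in its own ball-tensor: `τ_j = τ_j · 1 ∈ τ_j𝒪`. [folklore] -/
theorem τ_mem_ball (i : Fin lstar) : Ξ.τ i ∈ (Ξ.D i).ball 0 (Ξ.τ i) := by
  rw [VolumeDatum.ball_zero]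
  exact ⟨1, (Ξ.D i).O.one_mem, mul_one _⟩

/-- Lem. 9.10.7.1 at the exhibited element, in `ℝ≥0∞`: `∏_j |τ_j| ≤ Vol(hull Θ̃^𝓘_{Mochizuki,w})` (p.127 l.53–55).
PROVED (`TensorVolumeDatum.lemma_9_10_7_1` with `s = τ`, `S′ =` the locus). [claim: Joshi2024ATS3, status: disputed] -/
theorem ofReal_prod_abs_le_vol_hull :
    ENNReal.ofReal (∏ i, (Ξ.D i).abs (Ξ.τ i)) ≤ Ξ.vol (Ξ.hull Ξ.locus) :=
  Ξ.toTensorVolumeDatum.lemma_9_10_7_1 Ξ.τ Ξ.τ Ξ.τ_mem Ξ.τ_ne Ξ.τ_mem_ball Ξ.tens_subset_locus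

/-- **DISCHARGE of E-t4's reading predicate `HullVolumeLowerBound`** («Lemma 9.10.7.1 applied to the exhibited
element», `ATS3.LocusDatum.HullVolumeLowerBound : ∏ theta ≤ hullVol`) for the projection of any exhibited-element
datum: a CONSEQUENCE of the typed §9.10 objects and the signature fields, not a hypothesis. PROVED.
[claim: Joshi2024ATS3, status: disputed] -/
theorem hullVolumeLowerBound_toLocusDatum : Ξ.toLocusDatum.HullVolumeLowerBound := by
  unfold ATS3.LocusDatum.HullVolumeLowerBound
  rw [toLocusDatum_hullVol]
  exact (ENNReal.ofReal_le_iff_le_toReal Ξ.vol_hull_ne_top).1 Ξ.ofReal_prod_abs_le_vol_hull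

/-- **Thm. 9.11.1 at the place `w` for the projection, from (9.9.4) alone**: E-t4's `fundamentalEstimateVol_of`
with its second input discharged. `ValuationScaling` (the valuation-scaling identity at the standard point, Thm.
4.2.2.1 (4)) remains a hypothesis BY NAME. [claim: Joshi2024ATS3, status: disputed] -/
theorem fundamentalEstimateVol_of_valuationScaling (h : Ξ.toLocusDatum.ValuationScaling) :
    Ξ.toLocusDatum.FundamentalEstimateVol :=
  Ξ.toLocusDatum.fundamentalEstimateVol_of h Ξ.hullVolumeLowerBound_toLocusDatum

/-- **Cor. 9.11.1.1 at the place `w` for the projection**, from (9.9.4) and the sign convention `Vol ≤ 1` (p.128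
l.9–10) — E-t4's `cor91111_of_inputs` with `HullVolumeLowerBound` discharged. [claim: Joshi2024ATS3, status: disputed] -/
theorem cor91111_of_valuationScaling (h : Ξ.toLocusDatum.ValuationScaling) (h1 : Ξ.toLocusDatum.LogVolNonpos) :
    Ξ.toLocusDatum.Cor91111 :=
  Ξ.toLocusDatum.cor91111_of_inputs h Ξ.hullVolumeLowerBound_toLocusDatum h1

/-- Under (9.9.4) the hull of the `w`-locus has POSITIVE volume (so `LogVol(hull Θ̃_w) ∈ ℝ`, not `−∞`): the typed
form of «the volume of this set can be bounded [below]». PROVED. [claim: Joshi2024ATS3, status: disputed] -/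
theorem vol_hull_pos_of_valuationScaling (h : Ξ.toLocusDatum.ValuationScaling) : 0 < Ξ.vol (Ξ.hull Ξ.locus) := by
  have hpos : 0 < (Ξ.vol (Ξ.hull Ξ.locus)).toReal :=
    Ξ.toLocusDatum.hullVol_pos (Ξ.fundamentalEstimateVol_of_valuationScaling h)
  exact ENNReal.toReal_pos_iff.1 hpos |>.1

end ExhibitedDatum

end Summit.ABC.IUTFork.Joshi.LogVol

end
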